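import Literature.Algebra.Polynomial.PowerSeriesInDeltaOperator
import Mathlib.Tactic
import HarnessLib

/-!
# Umbral operators (Rota–Kahaner–Odlyzko §7, Propositions 1–2)

G.-C. Rota, D. Kahaner, A. Odlyzko, *Finite operator calculus* (1973), §7 "Umbral composition":

> If `a_n (x)` is a polynomial sequence, then there is a unique linear operator `L` on `P` such that
> `L (xⁿ) = a_n (x)`. We say that `L` is the *umbral representation* of the sequence `a_n (x)`. …
> An *umbral operator* is an operator `T` which maps some basic sequence `p_n (x)` into another
> basic sequence `q_n (x)`, that is, `T p_n (x) = q_n (x)`. … the *umbral composition* of two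
> polynomial sequences `a_n (x) = Σ_k a_{nk} x^k` and `b_n (x)`. This is the sequence of
> polynomials `c_n (x)` defined by `c_n (x) = Σ_k a_{nk} b_k (x)` … `c_n (x) = a_n (b (x))`.
> When `a_n (x) = xⁿ`, we simply write `c_n (x) = b (x)ⁿ`. … if `T` maps `xⁿ` to `q_n (x)`, then
> `a (q (x)) = T a (x)`, so that umbral composition of polynomials is simply the application of
> umbral operators, and conversely.
> **Proposition 1.** Let `T` be an umbral operator. Then `T⁻¹` exists and (a) the map
> `S → T S T⁻¹` is an automorphism of the algebra `Σ` of shift-invariant operators; (b) `T` maps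
> every sequence of basic polynomials into a sequence of basic polynomials; (c) if `Q` is a delta
> operator, then `P = T Q T⁻¹` is also a delta operator; (d) `T` maps every Sheffer set into a
> Sheffer set; (e) if `S = s (Q)`, where `s (t)` is a formal power series, then `T S T⁻¹ = s (P)`,
> where `P` is as in (c). [Proof: "`T P p_n (x) = T (n p_{n−1} (x)) = n q_{n−1} (x) = Q q_n (x) =
> Q T p_n (x)` … that is, `T P = Q T`. … `T S T⁻¹ = Σ a_n/n! · Qⁿ` (1)".]
> **Proposition 2.** Let `W r_n (x) = s_n (x)`, where both are Sheffer sets. Then `W = S⁻¹ T R`,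
> where `R` and `S` are the invertible operators of `r_n (x)` and `s_n (x)` and where `T` is the
> umbral operator mapping the basic set `p_n (x)` of `r_n (x)` to the basic set `q_n (x)` of `s_n (x)`.

Dictionary. `umbral b` is the umbral representation `xⁿ ↦ b_n` (a `K`-linear endomorphism of
`K[X]`); `umbralComp a b n = umbral b (a n)` is `a_n (b (x))`; for basic sequences `(p_n)` of `P`
and `(q_n)` of `Q` the umbral operator `T : p_n ↦ q_n` together with its inverse is the linear
equivalence `IsBasicSequence.umbralEquiv hp hq`, and `T S T⁻¹` is Mathlib's `LinearEquiv.conj`.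
Statements about a general umbral operator take any linear `T` with `T p_n = q_n`. Sheffer sets are
in the tree's normalization `s_n = S p_n` (Robert §6.1), so Proposition 2 reads `W ∘ R = S ∘ T`.

Main statements: `umbral_X_pow`, `umbral_eq_sum`, `umbralComp_eq_sum`, `umbral_eq_umbralEquiv`
("umbral composition … is simply the application of umbral operators");
`IsBasicSequence.umbral_comp_eq_comp` (`T P = Q T`), `umbral_map_eq_sum`, `natDegree_umbralEquiv`,
`eval_zero_umbral_map`; Proposition 1: (a) `isShiftInvariant_conj`, `exists_conj_eq`,
(e) `indicator_conj`, `conj_eq_diffOp`, `conj_self`, (c) `isDeltaOperator_conj`,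
(b) `isBasicSequence_umbralEquiv_map`, (d) `isShefferSequence_umbralEquiv_map`;
Proposition 2: `umbral_comp_eq_of_sheffer`.

## References
* [RotaKahanerOdlyzko1973] G.-C. Rota, D. Kahaner, A. Odlyzko, *On the foundations of
  combinatorial theory VIII. Finite operator calculus*, J. Math. Anal. Appl. 42 (1973) 684–760,
  §7 pp. 705–708 (umbral representation, umbral operators, umbral composition, Propositions 1–2).
* [Robert2000PadicAnalysis] A. M. Robert, *A Course in p-adic Analysis*, GTM 198, Springer (2000),
  Ch. IV §5.5 umbral table ("`T ↓ umbral operator`"), p. 204.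
-/

noncomputable section

open Polynomial Finset

namespace Literature.Algebra.Polynomial

variable {K : Type*} [Field K]

section Definitions

/-- The **umbral representation** of a sequence `(b_n)`: the unique linear operator `L` on `K[X]`
with `L (xⁿ) = b_n` (so `L (Σ_k a_k x^k) = Σ_k a_k b_k`).
[cite: RotaKahanerOdlyzko1973, §7 (umbral representation), p. 706] -/
def umbral (b : ℕ → K[X]) : K[X] →ₗ[K] K[X] :=
  Polynomial.lsum fun k => (LinearMap.id : K →ₗ[K] K).smulRight (b k)

/-- The **umbral composition** `c_n (x) = a_n (b (x)) = Σ_k a_{nk} b_k (x)` of two sequences of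
polynomials (`a_n = Σ_k a_{nk} x^k`). [cite: RotaKahanerOdlyzko1973, §7 (umbral composition), p. 706] -/
def umbralComp (a b : ℕ → K[X]) (n : ℕ) : K[X] :=
  umbral b (a n)

end Definitions

/-! ## The umbral representation `xⁿ ↦ b_n` and umbral composition -/

/-- `umbral b f = Σ_{k} f_k b_k` (sum over the support of `f`).
[cite: RotaKahanerOdlyzko1973, §7, p. 706] -/
theorem umbral_apply (b : ℕ → K[X]) (f : K[X]) : umbral b f = f.sum fun k c => c • b k := by
  rw [umbral, Polynomial.lsum_apply]
  rfl

/-- `umbral b f = Σ_{k<N} f_k b_k` for any `N > deg f`. [cite: RotaKahanerOdlyzko1973, §7, p. 706] -/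
theorem umbral_eq_sum (b : ℕ → K[X]) (f : K[X]) {N : ℕ} (hN : f.natDegree < N) :
    umbral b f = ∑ k ∈ range N, f.coeff k • b k := by
  rw [umbral_apply, Polynomial.sum_over_range' f (fun k => zero_smul K (b k)) N hN]

/-- **`umbral b (xⁿ) = b_n`.** [cite: RotaKahanerOdlyzko1973, §7 ("`L (xⁿ) = a_n (x)`"), p. 706] -/
theorem umbral_X_pow (b : ℕ → K[X]) (n : ℕ) : umbral b (X ^ n) = b n := by
  rw [umbral_apply, X_pow_eq_monomial, sum_monomial_index _ (fun k c => c • b k) (zero_smul K (b n)),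
    one_smul]

/-- `umbral b x = b_1`. [cite: RotaKahanerOdlyzko1973, §7, p. 706] -/
theorem umbral_X (b : ℕ → K[X]) : umbral b X = b 1 := by
  rw [← pow_one X, umbral_X_pow]

/-- `umbral b 1 = b_0`. [cite: RotaKahanerOdlyzko1973, §7, p. 706] -/
theorem umbral_one (b : ℕ → K[X]) : umbral b 1 = b 0 := by
  rw [← pow_zero X, umbral_X_pow]

/-- `umbral b (C a) = a · b_0`. [cite: RotaKahanerOdlyzko1973, §7, p. 706] -/
theorem umbral_C (b : ℕ → K[X]) (a : K) : umbral b (C a) = a • b 0 := by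
  rw [← mul_one (C a), ← smul_eq_C_mul, map_smul, umbral_one]

/-- The umbral representation of `(xⁿ)` is the identity.
[cite: RotaKahanerOdlyzko1973, §7, p. 706] -/
theorem umbral_X_pow_eq_id : umbral (K := K) (fun n => X ^ n) = LinearMap.id := by
  apply LinearMap.ext
  intro f
  rw [umbral_eq_sum _ f (lt_add_one _), LinearMap.id_apply]
  conv_rhs => rw [f.as_sum_range_C_mul_X_pow]
  exact sum_congr rfl fun k _ => by rw [smul_eq_C_mul]

/-- The uniqueness clause: a linear operator with `L (xⁿ) = b_n` is `umbral b`.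
[cite: RotaKahanerOdlyzko1973, §7 ("there is a unique linear operator `L`"), p. 706] -/
theorem eq_umbral_of_map_X_pow {b : ℕ → K[X]} {L : K[X] →ₗ[K] K[X]} (h : ∀ n, L (X ^ n) = b n) :
    L = umbral b :=
  isBasicSequence_derivative_X_pow.linearMap_ext fun n => by rw [h, umbral_X_pow]

/-- Unfolding: `(a ∘ b)_n = umbral b (a_n)`. [cite: RotaKahanerOdlyzko1973, §7, p. 706] -/
theorem umbralComp_apply (a b : ℕ → K[X]) (n : ℕ) : umbralComp a b n = umbral b (a n) := rfl

/-- `a_n (b (x)) = Σ_{k<N} a_{nk} b_k (x)` (`N > deg a_n`), as printed.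
[cite: RotaKahanerOdlyzko1973, §7 ("`c_n (x) = Σ_k a_{nk} b_k (x)`"), p. 706] -/
theorem umbralComp_eq_sum (a b : ℕ → K[X]) (n : ℕ) {N : ℕ} (hN : (a n).natDegree < N) :
    umbralComp a b n = ∑ k ∈ range N, (a n).coeff k • b k :=
  umbral_eq_sum b (a n) hN

/-- "When `a_n (x) = xⁿ`, we simply write `c_n (x) = b (x)ⁿ`": `xⁿ ∘ b = b_n`.
[cite: RotaKahanerOdlyzko1973, §7, p. 706] -/
theorem umbralComp_X_pow_left (b : ℕ → K[X]) : umbralComp (fun n => X ^ n) b = b :=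
  funext fun n => umbral_X_pow b n

/-- `a ∘ (xⁿ) = a`. [cite: RotaKahanerOdlyzko1973, §7, p. 706] -/
theorem umbralComp_X_pow_right (a : ℕ → K[X]) : umbralComp a (fun n => X ^ n) = a :=
  funext fun n => by rw [umbralComp_apply, umbral_X_pow_eq_id, LinearMap.id_apply]

/-! ## Umbral operators `T : p_n ↦ q_n` between basic sequences -/

namespace IsBasicSequence

variable {P Q : K[X] →ₗ[K] K[X]} {p q : ℕ → K[X]}

/-- **The umbral operator `T : p_n ↦ q_n`** between two basic sequences, packaged with its inverse
`T⁻¹ : q_n ↦ p_n` ("Let `T` be an umbral operator. Then `T⁻¹` exists") as a linear equivalence of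
`K[X]` (the basis `(p_n)` is sent onto the basis `(q_n)`).
[cite: RotaKahanerOdlyzko1973, §7 (umbral operator) and Proposition 1, pp. 706–707]
[cite: Robert2000PadicAnalysis, Ch. IV §5.5 (umbral table: "`T ↓ umbral operator`"), p. 204] -/
def umbralEquiv (hp : IsBasicSequence P p) (hq : IsBasicSequence Q q) : K[X] ≃ₗ[K] K[X] :=
  hp.basis.equiv hq.basis (Equiv.refl ℕ)

/-- `T p_n = q_n`. [cite: RotaKahanerOdlyzko1973, §7, p. 706] -/
theorem umbralEquiv_apply (hp : IsBasicSequence P p) (hq : IsBasicSequence Q q) (n : ℕ) :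
    hp.umbralEquiv hq (p n) = q n := by
  have h := hp.basis.equiv_apply (b' := hq.basis) n (Equiv.refl ℕ)
  rwa [hp.basis_apply, Equiv.refl_apply, hq.basis_apply] at h

/-- `T⁻¹` is the umbral operator `q_n ↦ p_n`. [cite: RotaKahanerOdlyzko1973, §7 Proposition 1
("`T⁻¹` exists"), p. 707] -/
theorem umbralEquiv_symm (hp : IsBasicSequence P p) (hq : IsBasicSequence Q q) :
    (hp.umbralEquiv hq).symm = hq.umbralEquiv hp := by
  rw [umbralEquiv, Module.Basis.equiv_symm]
  rfl

/-- `T⁻¹ q_n = p_n`. [cite: RotaKahanerOdlyzko1973, §7 Proposition 1, p. 707] -/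
theorem umbralEquiv_symm_apply (hp : IsBasicSequence P p) (hq : IsBasicSequence Q q) (n : ℕ) :
    (hp.umbralEquiv hq).symm (q n) = p n := by
  rw [hp.umbralEquiv_symm hq, hq.umbralEquiv_apply hp]

/-- A linear map with `T p_n = q_n` IS the umbral operator.
[cite: RotaKahanerOdlyzko1973, §7, p. 706] -/
theorem eq_umbralEquiv (hp : IsBasicSequence P p) (hq : IsBasicSequence Q q) {T : K[X] →ₗ[K] K[X]}
    (hT : ∀ n, T (p n) = q n) : T = (hp.umbralEquiv hq : K[X] →ₗ[K] K[X]) :=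
  hp.linearMap_ext fun n => by rw [hT, LinearEquiv.coe_coe, hp.umbralEquiv_apply hq]

/-- **"If `T` maps `xⁿ` to `q_n (x)`, then `a (q (x)) = T a (x)`"**: the umbral representation
`umbral q` is the umbral operator from `(xⁿ)` to `(q_n)`.
[cite: RotaKahanerOdlyzko1973, §7, p. 706] -/
theorem _root_.Literature.Algebra.Polynomial.umbral_eq_umbralEquiv (hq : IsBasicSequence Q q) :
    umbral q = (isBasicSequence_derivative_X_pow.umbralEquiv hq : K[X] →ₗ[K] K[X]) :=
  isBasicSequence_derivative_X_pow.eq_umbralEquiv hq (umbral_X_pow q)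

/-- "Umbral composition of polynomials is simply the application of umbral operators":
`a_n (q (x)) = T a_n` for the umbral operator `T : xⁿ ↦ q_n`.
[cite: RotaKahanerOdlyzko1973, §7, p. 706] -/
theorem _root_.Literature.Algebra.Polynomial.umbralComp_eq_umbralEquiv_apply (hq : IsBasicSequence Q q)
    (a : ℕ → K[X]) (n : ℕ) :
    umbralComp a q n = isBasicSequence_derivative_X_pow.umbralEquiv hq (a n) := by
  rw [umbralComp_apply, umbral_eq_umbralEquiv hq, LinearEquiv.coe_coe]

/-- **"`T P = Q T`"** for an umbral operator `T : p_n ↦ q_n` (`P`, `Q` the delta operators of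
`(p_n)`, `(q_n)`): `T P p_n = n q_{n−1} = Q T p_n`.
[cite: RotaKahanerOdlyzko1973, §7 (proof of Proposition 1 (a)), p. 707] -/
theorem umbral_comp_eq_comp (hP : IsDeltaOperator P) (hp : IsBasicSequence P p) (hQ : IsDeltaOperator Q)
    (hq : IsBasicSequence Q q) {T : K[X] →ₗ[K] K[X]} (hT : ∀ n, T (p n) = q n) :
    T ∘ₗ P = Q ∘ₗ T :=
  hp.linearMap_ext fun n => by
    rw [LinearMap.comp_apply, LinearMap.comp_apply]
    cases n with
    | zero => rw [hp.apply_zero, hP.map_one, map_zero, ← hp.apply_zero, hT, hq.apply_zero, hQ.map_one]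
    | succ n => rw [hp.map_succ, map_smul, hT, hT, hq.map_succ]

/-- `T Pᵏ = Qᵏ T`, pointwise. [cite: RotaKahanerOdlyzko1973, §7 (proof of Proposition 1:
"`T Pⁿ T⁻¹ = Qⁿ` for all `n`"), p. 707] -/
theorem umbral_map_pow_apply (hP : IsDeltaOperator P) (hp : IsBasicSequence P p)
    (hQ : IsDeltaOperator Q) (hq : IsBasicSequence Q q) {T : K[X] →ₗ[K] K[X]} (hT : ∀ n, T (p n) = q n)
    (k : ℕ) (f : K[X]) : T ((P ^ k) f) = (Q ^ k) (T f) := by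
  induction k with
  | zero => rw [pow_zero, pow_zero, Module.End.one_apply, Module.End.one_apply]
  | succ k ih =>
    have h := LinearMap.congr_fun (hp.umbral_comp_eq_comp hP hQ hq hT) ((P ^ k) f)
    rw [LinearMap.comp_apply, LinearMap.comp_apply] at h
    rw [pow_succ', Module.End.mul_apply, h, ih, pow_succ', Module.End.mul_apply]

variable [CharZero K]

/-- An umbral operator acts through the expansion in the basis `(p_n)`:
`T f = Σ_{k<N} (Pᵏ f)(0)/k! · q_k` (`N > deg f`) — "`r_n = Σ_k a_k p_k` hence `T r_n = Σ_k a_k q_k`".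
[cite: RotaKahanerOdlyzko1973, §7 (proof of Proposition 1 (b)), p. 708] -/
theorem umbral_map_eq_sum (hP : IsDeltaOperator P) (hp : IsBasicSequence P p) {T : K[X] →ₗ[K] K[X]}
    (hT : ∀ n, T (p n) = q n) (f : K[X]) {N : ℕ} (hN : f.natDegree < N) :
    T f = ∑ k ∈ range N, (((P ^ k) f).eval 0 / (k.factorial : K)) • q k := by
  calc T f = T (∑ k ∈ range N, (((P ^ k) f).eval 0 / (k.factorial : K)) • p k) :=
        congrArg T (hp.eq_sum hP f hN)
    _ = ∑ k ∈ range N, (((P ^ k) f).eval 0 / (k.factorial : K)) • q k := by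
        rw [map_sum]
        exact sum_congr rfl fun k _ => by rw [map_smul, hT]

/-- An umbral operator does not raise degrees. [cite: RotaKahanerOdlyzko1973, §7 (proof of
Proposition 1: "it maps polynomials of degree `n` into polynomials of degree `n`"), p. 707] -/
theorem natDegree_umbral_map_le (hP : IsDeltaOperator P) (hp : IsBasicSequence P p)
    (hq : IsBasicSequence Q q) {T : K[X] →ₗ[K] K[X]} (hT : ∀ n, T (p n) = q n) (f : K[X]) :
    (T f).natDegree ≤ f.natDegree := by
  rw [hp.umbral_map_eq_sum hP hT f (lt_add_one _)]
  refine natDegree_sum_le_of_forall_le _ _ fun k hk => (natDegree_smul_le _ _).trans ?_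
  rw [hq.natDegree_eq]
  exact Nat.lt_succ_iff.1 (mem_range.1 hk)

/-- **An umbral operator preserves the value at `0`**: `(T f)(0) = f (0)` (the `p_0`-coefficient of
`f` is `f (0)`, and `q_k (0) = 0` for `k ≥ 1`) — "so that `s_n (0) = 0`".
[cite: RotaKahanerOdlyzko1973, §7 (proof of Proposition 1 (b)), p. 708] -/
theorem eval_zero_umbral_map (hP : IsDeltaOperator P) (hp : IsBasicSequence P p) (hq : IsBasicSequence Q q)
    {T : K[X] →ₗ[K] K[X]} (hT : ∀ n, T (p n) = q n) (f : K[X]) : (T f).eval 0 = f.eval 0 := by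
  rw [hp.umbral_map_eq_sum hP hT f (lt_add_one _), eval_finsetSum, sum_eq_single 0]
  · rw [pow_zero, Module.End.one_apply, Nat.factorial_zero, Nat.cast_one, div_one, eval_smul,
      hq.apply_zero, eval_one, smul_eq_mul, mul_one]
  · intro k _ hk
    rw [eval_smul, hq.eval_zero hk, smul_zero]
  · intro h
    exact absurd (mem_range.2 (Nat.succ_pos _)) h

/-- **"It is clear that `T` is invertible, since it maps polynomials of degree `n` into polynomials of
degree `n`"**: the umbral operator preserves `natDegree`. [cite: RotaKahanerOdlyzko1973, §7 (proof of
Proposition 1), p. 707] -/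
theorem natDegree_umbralEquiv (hP : IsDeltaOperator P) (hp : IsBasicSequence P p) (hQ : IsDeltaOperator Q)
    (hq : IsBasicSequence Q q) (f : K[X]) : (hp.umbralEquiv hq f).natDegree = f.natDegree := by
  refine le_antisymm (hp.natDegree_umbral_map_le hP hq (hp.umbralEquiv_apply hq) f) ?_
  have h := hq.natDegree_umbral_map_le hQ hp (hq.umbralEquiv_apply hp) (hp.umbralEquiv hq f)
  rwa [← hp.umbralEquiv_symm hq, LinearEquiv.coe_coe, LinearEquiv.symm_apply_apply] at h

/-- The umbral operator preserves `degree`. [cite: RotaKahanerOdlyzko1973, §7 (proof of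
Proposition 1), p. 707] -/
theorem degree_umbralEquiv (hP : IsDeltaOperator P) (hp : IsBasicSequence P p) (hQ : IsDeltaOperator Q)
    (hq : IsBasicSequence Q q) {f : K[X]} (hf : f ≠ 0) : (hp.umbralEquiv hq f).degree = f.degree := by
  have hne : hp.umbralEquiv hq f ≠ 0 := fun h => hf ((hp.umbralEquiv hq).map_eq_zero_iff.1 h)
  rw [degree_eq_natDegree hne, degree_eq_natDegree hf, hp.natDegree_umbralEquiv hP hQ hq]

/-! ## Proposition 1 (a), (e): `S ↦ T S T⁻¹` on composition operators -/

/-- **Proposition 1 (e), formula (1)**: for a composition operator `S = Σ_k a_k/k! · Pᵏ`,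
`T S T⁻¹ = Σ_k a_k/k! · Qᵏ`, i.e. `T S T⁻¹ = ((indicator_P S) ∘ φ)(D)` for `Q = φ(D)`.
[cite: RotaKahanerOdlyzko1973, §7 Proposition 1 (e) and proof formula (1), p. 707] -/
theorem conj_eq_diffOp (hP : IsDeltaOperator P) (hp : IsBasicSequence P p) (hQ : IsDeltaOperator Q)
    (hq : IsBasicSequence Q q) {S : K[X] →ₗ[K] K[X]} (hS : IsShiftInvariant S) {φ : PowerSeries K}
    (hQφ : Q = diffOp φ) :
    ((hp.umbralEquiv hq).conj S : K[X] →ₗ[K] K[X]) = diffOp ((hP.indicator S).subst φ) := by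
  apply LinearMap.ext
  intro g
  set f := (hp.umbralEquiv hq).symm g with hf
  have hN1 : f.natDegree < max f.natDegree g.natDegree + 1 := by omega
  have hN2 : g.natDegree < max f.natDegree g.natDegree + 1 := by omega
  rw [LinearEquiv.conj_apply_apply, ← hf, hS.eq_sum_coeff_indicator_smul hP f hN1, map_sum,
    diffOp_subst (hQφ ▸ hQ).constantCoeff_eq_zero _ g hN2, ← hQφ]
  refine sum_congr rfl fun k _ => ?_
  have h2 := hp.umbral_map_pow_apply hP hQ hq (hp.umbralEquiv_apply hq) k f
  rw [LinearEquiv.coe_coe] at h2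
  rw [map_smul, h2, hf, LinearEquiv.apply_symm_apply]

/-- **Proposition 1 (a)**: `T S T⁻¹` is a composition operator whenever `S` is.
[cite: RotaKahanerOdlyzko1973, §7 Proposition 1 (a), p. 707] -/
theorem isShiftInvariant_conj (hP : IsDeltaOperator P) (hp : IsBasicSequence P p) (hQ : IsDeltaOperator Q)
    (hq : IsBasicSequence Q q) {S : K[X] →ₗ[K] K[X]} (hS : IsShiftInvariant S) :
    IsShiftInvariant ((hp.umbralEquiv hq).conj S : K[X] →ₗ[K] K[X]) := by
  obtain ⟨φ, hQφ⟩ := isShiftInvariant_iff_exists_eq_diffOp.1 hQ.isShiftInvariant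
  rw [hp.conj_eq_diffOp hP hQ hq hS hQφ]
  exact isShiftInvariant_diffOp _

/-- **Proposition 1 (e)**: "if `S = s (P)` then `T S T⁻¹ = s (Q)`" — conjugation by the umbral
operator carries the `P`-indicator to the `Q`-indicator.
[cite: RotaKahanerOdlyzko1973, §7 Proposition 1 (e), p. 707] -/
theorem indicator_conj (hP : IsDeltaOperator P) (hp : IsBasicSequence P p) (hQ : IsDeltaOperator Q)
    (hq : IsBasicSequence Q q) {S : K[X] →ₗ[K] K[X]} (hS : IsShiftInvariant S) :
    hQ.indicator ((hp.umbralEquiv hq).conj S : K[X] →ₗ[K] K[X]) = hP.indicator S := by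
  obtain ⟨φ, hQφ⟩ := isShiftInvariant_iff_exists_eq_diffOp.1 hQ.isShiftInvariant
  rw [hp.conj_eq_diffOp hP hQ hq hS hQφ, hQ.indicator_diffOp_subst hQφ]

omit [CharZero K] in
/-- **`T P T⁻¹ = Q`.** [cite: RotaKahanerOdlyzko1973, §7 (proof of Proposition 1: "Hence
`T P T⁻¹ = Q`"), p. 707] -/
theorem conj_self (hP : IsDeltaOperator P) (hp : IsBasicSequence P p) (hQ : IsDeltaOperator Q)
    (hq : IsBasicSequence Q q) : ((hp.umbralEquiv hq).conj P : K[X] →ₗ[K] K[X]) = Q := by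
  apply LinearMap.ext
  intro g
  have h := LinearMap.congr_fun (hp.umbral_comp_eq_comp hP hQ hq (hp.umbralEquiv_apply hq))
    ((hp.umbralEquiv hq).symm g)
  rw [LinearMap.comp_apply, LinearMap.comp_apply, LinearEquiv.coe_coe, LinearEquiv.apply_symm_apply] at h
  rw [LinearEquiv.conj_apply_apply, h]

omit [CharZero K] in
/-- Proposition 1 (a), multiplicativity: `T (S₁ S₂) T⁻¹ = (T S₁ T⁻¹)(T S₂ T⁻¹)` (Mathlib's
`LinearEquiv.conj_comp`). [cite: RotaKahanerOdlyzko1973, §7 Proposition 1 (a), p. 707] -/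
theorem conj_comp (hp : IsBasicSequence P p) (hq : IsBasicSequence Q q) (S₁ S₂ : K[X] →ₗ[K] K[X]) :
    (hp.umbralEquiv hq).conj (S₁ ∘ₗ S₂) = (hp.umbralEquiv hq).conj S₁ ∘ₗ (hp.umbralEquiv hq).conj S₂ :=
  LinearEquiv.conj_comp _ S₂ S₁

/-- Proposition 1 (a), "the map `S → T S T⁻¹` is onto": every composition operator is a conjugate
`T S T⁻¹` of a composition operator `S` (namely `S = T⁻¹ S' T`).
[cite: RotaKahanerOdlyzko1973, §7 Proposition 1 (a) (proof: "the map is onto since any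
shift-invariant operator can be expanded in terms of `Q`"), p. 707] -/
theorem exists_conj_eq (hP : IsDeltaOperator P) (hp : IsBasicSequence P p) (hQ : IsDeltaOperator Q)
    (hq : IsBasicSequence Q q) {S' : K[X] →ₗ[K] K[X]} (hS' : IsShiftInvariant S') :
    ∃ S : K[X] →ₗ[K] K[X], IsShiftInvariant S ∧ (hp.umbralEquiv hq).conj S = S' := by
  refine ⟨(hp.umbralEquiv hq).symm.conj S', ?_, LinearEquiv.conj_conj_symm _ _⟩
  rw [hp.umbralEquiv_symm hq]
  exact hq.isShiftInvariant_conj hQ hP hp hS'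

omit [CharZero K] in
/-- Proposition 1 (a), injectivity of `S ↦ T S T⁻¹`.
[cite: RotaKahanerOdlyzko1973, §7 Proposition 1 (a), p. 707] -/
theorem conj_injective (hp : IsBasicSequence P p) (hq : IsBasicSequence Q q) :
    Function.Injective ((hp.umbralEquiv hq).conj : (K[X] →ₗ[K] K[X]) → (K[X] →ₗ[K] K[X])) :=
  (hp.umbralEquiv hq).conj.injective

/-! ## Proposition 1 (c), (b), (d) -/

/-- **Proposition 1 (c)**: "if `R` is a delta operator, then `T R T⁻¹` is also a delta operator"
("for delta operators the constant coefficient `a_0` vanishes while `a_1 ≠ 0`").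
[cite: RotaKahanerOdlyzko1973, §7 Proposition 1 (c), p. 707] -/
theorem isDeltaOperator_conj (hP : IsDeltaOperator P) (hp : IsBasicSequence P p) (hQ : IsDeltaOperator Q)
    (hq : IsBasicSequence Q q) {R : K[X] →ₗ[K] K[X]} (hR : IsDeltaOperator R) :
    IsDeltaOperator ((hp.umbralEquiv hq).conj R : K[X] →ₗ[K] K[X]) := by
  rw [(hp.isShiftInvariant_conj hP hQ hq hR.isShiftInvariant).isDeltaOperator_iff_indicator hQ,
    hp.indicator_conj hP hQ hq hR.isShiftInvariant]
  exact (hR.isShiftInvariant.isDeltaOperator_iff_indicator hP).1 hR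

/-- **Proposition 1 (b)**: an umbral operator maps every basic sequence `(r_n)` (of the delta
operator `R`) to a basic sequence, namely that of `T R T⁻¹`.
[cite: RotaKahanerOdlyzko1973, §7 Proposition 1 (b) and proof, pp. 707–708] -/
theorem isBasicSequence_umbralEquiv_map (hP : IsDeltaOperator P) (hp : IsBasicSequence P p)
    (hQ : IsDeltaOperator Q) (hq : IsBasicSequence Q q) {R : K[X] →ₗ[K] K[X]} {r : ℕ → K[X]}
    (hr : IsBasicSequence R r) :
    IsBasicSequence ((hp.umbralEquiv hq).conj R : K[X] →ₗ[K] K[X]) fun n => hp.umbralEquiv hq (r n) where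
  natDegree_eq n := by rw [hp.natDegree_umbralEquiv hP hQ hq, hr.natDegree_eq]
  map_succ n := by
    rw [LinearEquiv.conj_apply_apply, LinearEquiv.symm_apply_apply, hr.map_succ, map_smul]
  apply_zero := by
    rw [hr.apply_zero, ← hp.apply_zero, hp.umbralEquiv_apply hq, hq.apply_zero, hp.apply_zero]
  eval_zero_succ n := by
    have h := hp.eval_zero_umbral_map hP hq (hp.umbralEquiv_apply hq) (r (n + 1))
    rw [LinearEquiv.coe_coe] at h
    rw [h, hr.eval_zero_succ]

/-- **Proposition 1 (d)**: an umbral operator maps every Sheffer set (relative to `R`) to a Sheffer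
set (relative to `T R T⁻¹`). [cite: RotaKahanerOdlyzko1973, §7 Proposition 1 (d) and proof, p. 708] -/
theorem isShefferSequence_umbralEquiv_map (hP : IsDeltaOperator P) (hp : IsBasicSequence P p)
    (hQ : IsDeltaOperator Q) (hq : IsBasicSequence Q q) {R : K[X] →ₗ[K] K[X]} {s : ℕ → K[X]}
    (hs : IsShefferSequence R s) :
    IsShefferSequence ((hp.umbralEquiv hq).conj R : K[X] →ₗ[K] K[X]) fun n => hp.umbralEquiv hq (s n) where
  degree_eq n := by rw [hp.degree_umbralEquiv hP hQ hq (hs.ne_zero n), hs.degree_eq]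
  map_succ n := by
    rw [LinearEquiv.conj_apply_apply, LinearEquiv.symm_apply_apply, hs.map_succ, map_smul]

/-- "In view of the preceding result, the umbral composition of two sequences of basic polynomials
is again a basic sequence": `r_n (q (x))` is basic (for `T R T⁻¹`, `T : xⁿ ↦ q_n`).
[cite: RotaKahanerOdlyzko1973, §7 (after Proposition 1), p. 708] -/
theorem _root_.Literature.Algebra.Polynomial.IsBasicSequence.isBasicSequence_umbralComp
    (hQ : IsDeltaOperator Q) (hq : IsBasicSequence Q q) {R : K[X] →ₗ[K] K[X]} {r : ℕ → K[X]}
    (hr : IsBasicSequence R r) :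
    IsBasicSequence ((isBasicSequence_derivative_X_pow.umbralEquiv hq).conj R : K[X] →ₗ[K] K[X])
      (umbralComp r q) := by
  have h := isBasicSequence_derivative_X_pow.isBasicSequence_umbralEquiv_map isDeltaOperator_derivative
    hQ hq hr
  convert h using 2 with n
  exact umbralComp_eq_umbralEquiv_apply hq r n

/-! ## Proposition 2 -/

omit [CharZero K] in
/-- **Proposition 2** (tree normalization `r_n = R p_n`, `s_n = S q_n` of Sheffer sets): an operator
`W` with `W r_n = s_n` satisfies `W R = S T` (`T` the umbral operator `p_n ↦ q_n`; printed as
`W = S⁻¹ T R` in the normalization `r_n = R⁻¹ p_n`, `s_n = S⁻¹ q_n`).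
[cite: RotaKahanerOdlyzko1973, §7 Proposition 2, p. 708] -/
theorem umbral_comp_eq_of_sheffer (hp : IsBasicSequence P p) {T : K[X] →ₗ[K] K[X]}
    (hT : ∀ n, T (p n) = q n) {R S W : K[X] →ₗ[K] K[X]} {r s : ℕ → K[X]} (hr : ∀ n, R (p n) = r n)
    (hs : ∀ n, S (q n) = s n) (hW : ∀ n, W (r n) = s n) : W ∘ₗ R = S ∘ₗ T :=
  hp.linearMap_ext fun n => by rw [LinearMap.comp_apply, LinearMap.comp_apply, hr, hW, hT, hs]

end IsBasicSequence

end Literature.Algebra.Polynomial
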